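import Mathlib
import Summits.Ventures.HodgeRepro.Tier4.Line4.CharacterPairSeesaw

/-!
# Tier4/Line4/CharacterPairSeesawCover — the cocompactness of `Z(𝔸)` modulo `T′(k)` INSIDE `T′(𝔸)`, and the wall's
PAIR on the seesaw plane with that clause discharged (C-L4-B-EXTEND, part 6)

Blind re-derivation cell `pub-hodge-repro`, Tier 4 «prove the step» (README §9–§10), seat t4-x2 (reserve
wall-breaker, gen 6; GO S16576).  Tree path `lean/Summits/Ventures/HodgeRepro/Tier4/Line4/CharacterPairSeesawCover.lean`.
Imports: Mathlib + `Tier4/Line4/CharacterPairSeesaw` (and through it CentreCocompactAniso (L4-p2, p720362):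
`centre_cocompact_of_anisotropic`; CentreCocompact (typer-2): `isClosed_centre_subgroupOf_torusT`; L2-p3's
`rationalCentreT`; AdelicHaar's `isClosed_torusT'`).  No definition, no instance, no printed theorem proved.

WHAT.  CharacterPairSeesaw's pair theorem displays `hZ` — `Z(𝔸) ⊆ T′(k) · D` with `D ⊆ Z(𝔸)` compact, inside
`T′(𝔸)`.  L4-p2's `centre_cocompact_of_anisotropic` is that statement INSIDE `T(𝔸)` (`Z ⊆ Z(k) · L`, `L` compact).
* `exists_compact_centre_cover_torusT'` — the transport through `Z ≤ T ⊓ T′`: `D` := the preimage in `T′(𝔸)` of the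
  image in `G(𝔸)` of the compact `L ∩ Z` (closed embeddings both ways); the rational factor `r ∈ Z(k)` is read in
  `T′(k)`.  (Membership transports are done by `rw [rationalOf, Subgroup.mem_subgroupOf]`, not by the `Iff.rfl`
  projections — the kernel times out on the latter; census.)
* **`exists_wall_character'_pair_seesaw_of_aniso`** — CharacterPairSeesaw's `exists_wall_character'_pair_seesaw` with
  `hZ` discharged by name: the wall's `chi′` with `_hchi'` and `chi_centre` modulo the print `hDE'` and `hcons` only.
Nothing here says anything about the status of the Hodge conjecture for CM abelian varieties, which is NOT proved;
HC_CM is NOT proved by anyone in this repository.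
-/

set_option autoImplicit false

noncomputable section

namespace Summit.Ventures.HodgeRepro.Tier4.Line4

open NumberField Matrix Summit.Ventures.HodgeRepro.Tier4.Common Summit.Ventures.HodgeRepro.Tier4.Line1
  Summit.Ventures.HodgeRepro.Tier4.Lit
open scoped Pointwise

section Cover

variable {k : Type} [Field k] [NumberField k]

/-- **`Z(𝔸)` is cocompact modulo `T′(k)` inside `T′(𝔸)`** (any anisotropic genuine plane): L4-p2's
`centre_cocompact_of_anisotropic` (`Z ⊆ Z(k) · L` in `T(𝔸)`, `L` compact) read in `T′(𝔸)` through `Z ≤ T ⊓ T′` — the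
compact set is the preimage in `T′(𝔸)` of the image in `G(𝔸)` of `L ∩ Z`. -/
theorem exists_compact_centre_cover_torusT' (W : PlaneData k) (hg : IsGenuineRow W) (hA : IsAnisotropic W) :
    ∃ D : Set (torusT' W), IsCompact D ∧
      D ⊆ (((centre W).subgroupOf (torusT' W) : Subgroup (torusT' W)) : Set (torusT' W)) ∧
      ∀ z ∈ (centre W).subgroupOf (torusT' W), ∃ γ ∈ rationalOf W (torusT' W), ∃ d ∈ D, z = γ * d := by
  obtain ⟨L, hL, hsub⟩ := centre_cocompact_of_anisotropic hg hA
  set Zc : Subgroup (torusT W) := (centre W).subgroupOf (torusT W) with hZc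
  have hLZ : IsCompact (L ∩ (Zc : Set (torusT W))) := hL.inter_right (isClosed_centre_subgroupOf_torusT W)
  have hLg : IsCompact (Subtype.val '' (L ∩ (Zc : Set (torusT W))) : Set (GA W)) := hLZ.image continuous_subtype_val
  have hD : IsCompact (Subtype.val ⁻¹' (Subtype.val '' (L ∩ (Zc : Set (torusT W)))) : Set (torusT' W)) :=
    (Common.isClosed_torusT' W).isClosedEmbedding_subtypeVal.isCompact_preimage hLg
  refine ⟨_, hD, ?_, ?_⟩
  · rintro y ⟨x, ⟨_, hxZ⟩, hxy⟩
    rw [SetLike.mem_coe, Subgroup.mem_subgroupOf]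
    rw [SetLike.mem_coe, hZc, Subgroup.mem_subgroupOf] at hxZ
    rw [← hxy]
    exact hxZ
  · intro z hz
    have hz' : (z : GA W) ∈ centre W := by rwa [Subgroup.mem_subgroupOf] at hz
    have hz₁ : (⟨(z : GA W), centre_le_torusT W hz'⟩ : torusT W) ∈ Zc := by
      rw [hZc, Subgroup.mem_subgroupOf]
      exact hz'
    obtain ⟨r, hr, l, hl, hrl⟩ := hsub hz₁
    have hrl' : r * l = (⟨(z : GA W), centre_le_torusT W hz'⟩ : torusT W) := hrl
    have hrZ : r ∈ Zc := (Subgroup.mem_inf.1 hr).2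
    have hlZ : l ∈ Zc := by
      have : l = r⁻¹ * (⟨(z : GA W), centre_le_torusT W hz'⟩ : torusT W) := by rw [← hrl', inv_mul_cancel_left]
      rw [this]
      exact Zc.mul_mem (Zc.inv_mem hrZ) hz₁
    have hrc : (r : GA W) ∈ centre W := by rwa [hZc, Subgroup.mem_subgroupOf] at hrZ
    have hlc : (l : GA W) ∈ centre W := by
      have h := hlZ
      rwa [hZc, Subgroup.mem_subgroupOf] at h
    have hrq : (r : GA W) ∈ rationalPoints W := by
      have h := (Subgroup.mem_inf.1 hr).1
      rwa [rationalOf, Subgroup.mem_subgroupOf] at h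
    have hγ : (⟨(r : GA W), centre_le_torusT' W hrc⟩ : torusT' W) ∈ rationalOf W (torusT' W) := by
      rw [rationalOf, Subgroup.mem_subgroupOf]
      exact hrq
    refine ⟨⟨(r : GA W), centre_le_torusT' W hrc⟩, hγ,
      ⟨(l : GA W), centre_le_torusT' W hlc⟩, ⟨l, ⟨hl, hlZ⟩, rfl⟩, ?_⟩
    apply Subtype.ext
    rw [Subgroup.coe_mul]
    have h2 : ((r * l : torusT W) : GA W) = (z : GA W) := congrArg Subtype.val hrl'
    rw [Subgroup.coe_mul] at h2
    exact h2.symm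

end Cover

section PairAniso

variable {k : Type} [Field k] [NumberField k] (q : QuadData k) (a : Fin 4 → k)
  (g g' : Matrix (Fin 4) (Fin 4) k) (hgg' : g * g' = 1) (hg'g : g' * g = 1)
  (hgΩ : g * (PlaneData.mixedRow q (a 0) (a 2)).Ω = (PlaneData.mixedRow q (a 0) (a 2)).Ω * g)
  (lam : k) (hlam : lam ≠ 0)
  (hiso : g * (PlaneData.mixedRow q (a 1) (a 3)).B * gᵀ = lam • (PlaneData.mixedRow q (a 0) (a 2)).B)

include lam hlam hiso in
/-- **THE WALL'S `chi′` WITH `_hchi'` AND `chi_centre` ON THE SEESAW PLANE, modulo the print and `hcons` ONLY**: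
CharacterPairSeesaw's pair theorem with the cocompactness clause `hZ` discharged by `exists_compact_centre_cover_torusT'`
(`IsGenuineRow` from `isGenuineRow_seesawPlane`, `IsAnisotropic` = `hA`). -/
theorem exists_wall_character'_pair_seesaw_of_aniso (ht : q.t = 0) (hn : ¬ IsSquare (-q.n)) (ha : ∀ i, a i ≠ 0)
    (hreal : ∀ w : InfinitePlace k, w.IsReal) (hcm : ∀ w, IsCMAt q w)
    (hA : IsAnisotropic ((PlaneData.mixedRow q (a 0) (a 2)).withTransportedTorus g g' hgg' hg'g hgΩ))
    (chi : torusT ((PlaneData.mixedRow q (a 0) (a 2)).withTransportedTorus g g' hgg' hg'g hgΩ) → ℂ)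
    (hmul : ∀ s t, chi (s * t) = chi s * chi t) (hcont : Continuous chi) (hunit : ∀ t, ‖chi t‖ = 1)
    (hDE' : letI : CommGroup (torusT' ((PlaneData.mixedRow q (a 0) (a 2)).withTransportedTorus g g' hgg' hg'g hgΩ)) :=
        { (inferInstance : Group (torusT' ((PlaneData.mixedRow q (a 0) (a 2)).withTransportedTorus g g' hgg' hg'g hgΩ)))
          with mul_comm := torusT'_seesaw_mul_comm q a g g' hgg' hg'g hgΩ lam hlam hiso (ha 1) (ha 3) }
      haveI : IsClosed ((rationalOf ((PlaneData.mixedRow q (a 0) (a 2)).withTransportedTorus g g' hgg' hg'g hgΩ)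
          (torusT' ((PlaneData.mixedRow q (a 0) (a 2)).withTransportedTorus g g' hgg' hg'g hgΩ)) :
          Subgroup (torusT' ((PlaneData.mixedRow q (a 0) (a 2)).withTransportedTorus g g' hgg' hg'g hgΩ))) :
          Set (torusT' ((PlaneData.mixedRow q (a 0) (a 2)).withTransportedTorus g g' hgg' hg'g hgΩ))) :=
        isClosed_rationalOf_torusT' _
      haveI : CompactSpace (torusT' ((PlaneData.mixedRow q (a 0) (a 2)).withTransportedTorus g g' hgg' hg'g hgΩ) ⧸
          rationalOf ((PlaneData.mixedRow q (a 0) (a 2)).withTransportedTorus g g' hgg' hg'g hgΩ)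
            (torusT' ((PlaneData.mixedRow q (a 0) (a 2)).withTransportedTorus g g' hgg' hg'g hgΩ))) :=
        compactSpace_quotient_of_cocompact _ (cocompact_rationalOf_torusT'_of_anisotropic _
          (isGenuineRow_seesawPlane q ht hn a (ha 0) (ha 2) g g' hgg' hg'g hgΩ lam hlam hiso) hA)
      DeitmarEchterhoff2014_Cor_3_6_2_restriction_surjective
        (torusT' ((PlaneData.mixedRow q (a 0) (a 2)).withTransportedTorus g g' hgg' hg'g hgΩ) ⧸
          rationalOf ((PlaneData.mixedRow q (a 0) (a 2)).withTransportedTorus g g' hgg' hg'g hgΩ)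
            (torusT' ((PlaneData.mixedRow q (a 0) (a 2)).withTransportedTorus g g' hgg' hg'g hgΩ))))
    (eP' eM' : InfinitePlace k → ℤ)
    (hcons : ∀ (t : torusT' ((PlaneData.mixedRow q (a 0) (a 2)).withTransportedTorus g g' hgg' hg'g hgΩ))
      (z : GA ((PlaneData.mixedRow q (a 0) (a 2)).withTransportedTorus g g' hgg' hg'g hgΩ))
      (hz : z ∈ centre ((PlaneData.mixedRow q (a 0) (a 2)).withTransportedTorus g g' hgg' hg'g hgΩ)),
      (t : GA _) ∈ infinitePart ((PlaneData.mixedRow q (a 0) (a 2)).withTransportedTorus g g' hgg' hg'g hgΩ) →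
      (t : GA _) * z ∈ rationalPoints ((PlaneData.mixedRow q (a 0) (a 2)).withTransportedTorus g g' hgg' hg'g hgΩ) →
      torusWeight' q a g g' hgg' hg'g hgΩ eP' eM' (t : GA _) * chi ⟨z, centre_le_torusT _ hz⟩ = 1) :
    ∃ chi' : torusT' ((PlaneData.mixedRow q (a 0) (a 2)).withTransportedTorus g g' hgg' hg'g hgΩ) → ℂ,
      (∀ s t, chi' (s * t) = chi' s * chi' t) ∧
      (∀ t ∈ rationalOf ((PlaneData.mixedRow q (a 0) (a 2)).withTransportedTorus g g' hgg' hg'g hgΩ)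
        (torusT' ((PlaneData.mixedRow q (a 0) (a 2)).withTransportedTorus g g' hgg' hg'g hgΩ)), chi' t = 1) ∧
      Continuous chi' ∧ (∀ t, ‖chi' t‖ = 1) ∧
      (∀ w : InfinitePlace k, ChiMatchesAt' ((PlaneData.mixedRow q (a 0) (a 2)).withTransportedTorus g g' hgg' hg'g hgΩ)
        q w g g' (eP' w) (eM' w) chi') ∧
      ∀ (z : GA ((PlaneData.mixedRow q (a 0) (a 2)).withTransportedTorus g g' hgg' hg'g hgΩ))
        (hz : z ∈ centre ((PlaneData.mixedRow q (a 0) (a 2)).withTransportedTorus g g' hgg' hg'g hgΩ)),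
        chi ⟨z, centre_le_torusT _ hz⟩ = chi' ⟨z, centre_le_torusT' _ hz⟩ :=
  exists_wall_character'_pair_seesaw q a g g' hgg' hg'g hgΩ lam hlam hiso ht hn ha hreal hcm hA
    (exists_compact_centre_cover_torusT' _
      (isGenuineRow_seesawPlane q ht hn a (ha 0) (ha 2) g g' hgg' hg'g hgΩ lam hlam hiso) hA)
    chi hmul hcont hunit hDE' eP' eM' hcons

end PairAniso

end Summit.Ventures.HodgeRepro.Tier4.Line4

end
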